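import Summits.AtomisticToContinuum.FouriersLaw.Theorems.PhononMeanFreePathIncoherentChannelContactLossHelper1

/-!
# `IncoherentChannel`, line `two-horizons-forecast-loss` — contact loss of the forecast norm, helper 2

Second of three files (see helper 1): the `N`-uniform `L²(μ₀ ⊗ W)` bound on the TIME-INTEGRATED bath-site drift along
the flow, `E(∫₀ᵗ Y_N(z_s) ds)² ≤ t² D²` whenever `‖Y_N‖²_{L²(μ₀)} ≤ D²` (`contactLoss_lintegral_driftIntegral_sq_le`):
Cauchy–Schwarz in time along each trajectory (`contactLoss_driftIntegral_sq_le_pointwise`), Tonelli on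
`(μ₀ ⊗ W) × [0,t]` (joint measurability `contactLoss_measurable_drift_solMap_uncurry`), and stationarity of every
time-`s` marginal (`contactLoss_lintegral_solMap_prod`). Vocabulary `PhononMeanFreePathDefs`; crux
`PhononMeanFreePath.IncoherentChannel` (stmt-AtomisticToContinuum-11811). No definitions; nothing here closes an item.
-/

noncomputable section

namespace Summit.AtomisticToContinuum.FouriersLaw.Theorems.PhononMeanFreePath

open MeasureTheory ProbabilityTheory Set Filter Topology
open scoped NNReal ENNReal
open Literature.MathematicalPhysics.KineticTheory.HeatConduction
open Literature.MathematicalPhysics.KineticTheory Literature.Probability.Process OscillatorChain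

/-! ### The time-integrated drift along the flow: an `N`-uniform `L²(μ₀ ⊗ W)` bound -/

section DriftIntegral

variable {ω₂ lam β γ T : ℝ} (hω : 0 < ω₂) (hl : 0 ≤ lam) (hβ : 0 ≤ β) (hγ : 0 ≤ γ) (hT : 0 < T) (N : ℕ)
include hω hl hβ hγ

omit hT in
/-- Joint measurability of `(p, s) ↦ Y_N(Φ_s(p))` on `(μ₀ ⊗ W) × ℝ`. [folklore] -/
theorem contactLoss_measurable_drift_solMap_uncurry :
    Measurable fun q : (PhaseSpace (N + 1) × WienerPair) × ℝ =>
      ((pinnedChain ω₂ lam β γ).drift (N + 1)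
        ((pinnedChain ω₂ lam β γ).solMap (N + 1) T T q.2 q.1.1 (pairPath q.1.2))).2 (Fin.last N) := by
  have h1 : Measurable fun q : (PhaseSpace (N + 1) × WienerPair) × ℝ => (q.2, (q.1.1, pairPath q.1.2)) :=
    measurable_snd.prodMk ((measurable_fst.comp measurable_fst).prodMk
      (measurable_pairPath.comp (measurable_snd.comp measurable_fst)))
  have h2 := (pinnedChain_measurable_uncurry_solMap hω hl hβ hγ (N + 1) T T).comp h1
  have h3 := (contactLoss_continuous_drift_last ω₂ lam β γ N).measurable.comp h2
  exact h3

include hT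

/-- Stationarity, Lebesgue form on the product space: `∫⁻ g(Φ_r) d(μ₀ ⊗ W) = ∫⁻ g dμ₀` for measurable `g ≥ 0`.
[cite: CuneoEckmannHairerReyBellet2018, §3.1] -/
theorem contactLoss_lintegral_solMap_prod (r : ℝ≥0) {g : PhaseSpace (N + 1) → ℝ≥0∞} (hg : Measurable g) :
    ∫⁻ p, g ((pinnedChain ω₂ lam β γ).solMap (N + 1) T T r p.1 (pairPath p.2))
        ∂(((pinnedChain ω₂ lam β γ).gibbsMeasure (N + 1) T).prod wienerPair) =
      ∫⁻ z, g z ∂((pinnedChain ω₂ lam β γ).gibbsMeasure (N + 1) T) := by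
  have hmap := contactLoss_map_solMap_prod hω hl hβ hγ hT N r
  have hm := pinnedChain_measurable_solMap_pairPath hω hl hβ hγ (N + 1) T T (r : ℝ)
  rw [← lintegral_map hg hm, hmap]

omit hT in
/-- **Cauchy–Schwarz in time** for the integrated drift along one trajectory:
`(∫₀ᵗ Y_N(z_s) ds)² ≤ t ∫₀ᵗ Y_N(z_s)² ds` (`t ≥ 0`; the integrand is continuous in `s`). [folklore] -/
theorem contactLoss_driftIntegral_sq_le_pointwise {t : ℝ} (ht : 0 ≤ t) (p : PhaseSpace (N + 1) × WienerPair) :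
    (∫ s in (0 : ℝ)..t, ((pinnedChain ω₂ lam β γ).drift (N + 1)
        ((pinnedChain ω₂ lam β γ).solMap (N + 1) T T s p.1 (pairPath p.2))).2 (Fin.last N)) ^ 2 ≤
      t * ∫ s in (0 : ℝ)..t, ((pinnedChain ω₂ lam β γ).drift (N + 1)
        ((pinnedChain ω₂ lam β γ).solMap (N + 1) T T s p.1 (pairPath p.2))).2 (Fin.last N) ^ 2 := by
  set f : ℝ → ℝ := fun s => ((pinnedChain ω₂ lam β γ).drift (N + 1)
    ((pinnedChain ω₂ lam β γ).solMap (N + 1) T T s p.1 (pairPath p.2))).2 (Fin.last N) with hf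
  have hfc : Continuous f :=
    (contactLoss_continuous_drift_last ω₂ lam β γ N).comp
      (pinnedChain_continuous_solMap hω hl hβ hγ (N + 1) T T p.1 (pairPath p.2))
  rw [intervalIntegral.integral_of_le ht, intervalIntegral.integral_of_le ht]
  have hμt : (volume : Measure ℝ) (Ioc 0 t) < ∞ := measure_Ioc_lt_top
  have hf2 : Integrable (fun s => f s ^ 2) ((volume : Measure ℝ).restrict (Ioc 0 t)) :=
    ((hfc.pow 2).integrableOn_Icc (a := 0) (b := t)).mono_set Ioc_subset_Icc_self
  have h1 : Integrable (fun _ : ℝ => (1 : ℝ) ^ 2) ((volume : Measure ℝ).restrict (Ioc 0 t)) := by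
    simp only [one_pow]
    exact integrableOn_const hμt.ne
  have hcs := lightCone_integral_mul_sq_le (μ := (volume : Measure ℝ).restrict (Ioc 0 t)) (f := f)
    (g := fun _ => (1 : ℝ)) hfc.aestronglyMeasurable aestronglyMeasurable_const hf2 h1
  simp only [mul_one, one_pow] at hcs
  have hvol : ∫ _ in Ioc 0 t, (1 : ℝ) = t := by
    rw [setIntegral_const, Real.volume_real_Ioc_of_le ht, sub_zero, smul_eq_mul, mul_one]
  rw [hvol] at hcs
  simpa only [hf, mul_comm] using hcs

/-- **`N`-uniform second moment of the integrated drift** on `μ₀ ⊗ W` (Lebesgue form): if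
`‖Y_N‖²_{L²(μ₀)} ≤ D²` then `E (∫₀ᵗ Y_N(z_s) ds)² ≤ t² D²` — Cauchy–Schwarz in time, Tonelli, and stationarity of
every time-`s` marginal. [cite: CuneoEckmannHairerReyBellet2018, §3.1] -/
theorem contactLoss_lintegral_driftIntegral_sq_le {t : ℝ} (ht : 0 ≤ t) {Dsq : ℝ}
    (hDi : Integrable (fun z : PhaseSpace (N + 1) => ((pinnedChain ω₂ lam β γ).drift (N + 1) z).2 (Fin.last N) ^ 2)
      ((pinnedChain ω₂ lam β γ).gibbsMeasure (N + 1) T))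
    (hD : ∫ z, ((pinnedChain ω₂ lam β γ).drift (N + 1) z).2 (Fin.last N) ^ 2
      ∂((pinnedChain ω₂ lam β γ).gibbsMeasure (N + 1) T) ≤ Dsq) :
    ∫⁻ p, ENNReal.ofReal ((∫ s in (0 : ℝ)..t, ((pinnedChain ω₂ lam β γ).drift (N + 1)
        ((pinnedChain ω₂ lam β γ).solMap (N + 1) T T s p.1 (pairPath p.2))).2 (Fin.last N)) ^ 2)
        ∂(((pinnedChain ω₂ lam β γ).gibbsMeasure (N + 1) T).prod wienerPair) ≤
      ENNReal.ofReal (t ^ 2 * Dsq) := by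
  haveI : IsProbabilityMeasure ((pinnedChain ω₂ lam β γ).gibbsMeasure (N + 1) T) :=
    pinnedChain_isProbabilityMeasure_gibbsMeasure hω hl hβ γ (N + 1) hT
  set Pμ := ((pinnedChain ω₂ lam β γ).gibbsMeasure (N + 1) T).prod wienerPair with hPμ
  -- the integrand `Y_N(Φ_s(p))` as a function of `(p, s)`
  set F : (PhaseSpace (N + 1) × WienerPair) → ℝ → ℝ := fun p s => ((pinnedChain ω₂ lam β γ).drift (N + 1)
    ((pinnedChain ω₂ lam β γ).solMap (N + 1) T T s p.1 (pairPath p.2))).2 (Fin.last N) with hF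
  have hFm : Measurable (Function.uncurry F) := contactLoss_measurable_drift_solMap_uncurry hω hl hβ hγ N
  have hFc : ∀ p, Continuous (F p) := fun p =>
    (contactLoss_continuous_drift_last ω₂ lam β γ N).comp
      (pinnedChain_continuous_solMap hω hl hβ hγ (N + 1) T T p.1 (pairPath p.2))
  have hDsq0 : 0 ≤ Dsq := (integral_nonneg fun z => sq_nonneg _).trans hD
  -- step 1: Cauchy–Schwarz in time, inside `ofReal`
  have h1 : ∀ p, ENNReal.ofReal ((∫ s in (0 : ℝ)..t, F p s) ^ 2) ≤
      ENNReal.ofReal t * ∫⁻ s in Ioc 0 t, ENNReal.ofReal (F p s ^ 2) := by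
    intro p
    have hcs := contactLoss_driftIntegral_sq_le_pointwise (T := T) hω hl hβ hγ N ht p
    have hf2 : Integrable (fun s => F p s ^ 2) ((volume : Measure ℝ).restrict (Ioc 0 t)) :=
      (((hFc p).pow 2).integrableOn_Icc (a := 0) (b := t)).mono_set Ioc_subset_Icc_self
    calc ENNReal.ofReal ((∫ s in (0 : ℝ)..t, F p s) ^ 2)
        ≤ ENNReal.ofReal (t * ∫ s in (0 : ℝ)..t, F p s ^ 2) := ENNReal.ofReal_le_ofReal hcs
      _ = ENNReal.ofReal t * ENNReal.ofReal (∫ s in Ioc 0 t, F p s ^ 2) := by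
          rw [ENNReal.ofReal_mul ht, intervalIntegral.integral_of_le ht]
      _ = ENNReal.ofReal t * ∫⁻ s in Ioc 0 t, ENNReal.ofReal (F p s ^ 2) := by
          rw [ofReal_integral_eq_lintegral_ofReal hf2 (ae_of_all _ fun s => sq_nonneg _)]
  -- step 2: Tonelli and stationarity of every time marginal
  have hGm : Measurable fun q : (PhaseSpace (N + 1) × WienerPair) × ℝ => ENNReal.ofReal (F q.1 q.2 ^ 2) :=
    (hFm.pow_const 2).ennreal_ofReal
  have hg0 : Measurable fun z : PhaseSpace (N + 1) =>
      ENNReal.ofReal (((pinnedChain ω₂ lam β γ).drift (N + 1) z).2 (Fin.last N) ^ 2) :=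
    ((contactLoss_continuous_drift_last ω₂ lam β γ N).measurable.pow_const 2).ennreal_ofReal
  have hswap : ∫⁻ p, (∫⁻ s in Ioc 0 t, ENNReal.ofReal (F p s ^ 2)) ∂Pμ =
      ∫⁻ s in Ioc 0 t, (∫⁻ p, ENNReal.ofReal (F p s ^ 2) ∂Pμ) :=
    lintegral_lintegral_swap (hGm.aemeasurable)
  have hstat : ∀ s ∈ Ioc (0 : ℝ) t, (∫⁻ p, ENNReal.ofReal (F p s ^ 2) ∂Pμ) =
      ∫⁻ z, ENNReal.ofReal (((pinnedChain ω₂ lam β γ).drift (N + 1) z).2 (Fin.last N) ^ 2)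
        ∂((pinnedChain ω₂ lam β γ).gibbsMeasure (N + 1) T) := by
    intro s hs
    have h := contactLoss_lintegral_solMap_prod hω hl hβ hγ hT N s.toNNReal hg0
    rw [Real.coe_toNNReal s hs.1.le] at h
    exact h
  have hinner : ∫⁻ z, ENNReal.ofReal (((pinnedChain ω₂ lam β γ).drift (N + 1) z).2 (Fin.last N) ^ 2)
      ∂((pinnedChain ω₂ lam β γ).gibbsMeasure (N + 1) T) ≤ ENNReal.ofReal Dsq := by
    rw [← ofReal_integral_eq_lintegral_ofReal hDi (ae_of_all _ fun z => sq_nonneg _)]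
    exact ENNReal.ofReal_le_ofReal hD
  calc ∫⁻ p, ENNReal.ofReal ((∫ s in (0 : ℝ)..t, F p s) ^ 2) ∂Pμ
      ≤ ∫⁻ p, ENNReal.ofReal t * (∫⁻ s in Ioc 0 t, ENNReal.ofReal (F p s ^ 2)) ∂Pμ := lintegral_mono h1
    _ = ENNReal.ofReal t * ∫⁻ p, (∫⁻ s in Ioc 0 t, ENNReal.ofReal (F p s ^ 2)) ∂Pμ :=
        lintegral_const_mul' _ _ ENNReal.ofReal_ne_top
    _ = ENNReal.ofReal t * ∫⁻ s in Ioc 0 t, (∫⁻ p, ENNReal.ofReal (F p s ^ 2) ∂Pμ) := by rw [hswap]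
    _ = ENNReal.ofReal t * ∫⁻ s in Ioc 0 t,
          ∫⁻ z, ENNReal.ofReal (((pinnedChain ω₂ lam β γ).drift (N + 1) z).2 (Fin.last N) ^ 2)
            ∂((pinnedChain ω₂ lam β γ).gibbsMeasure (N + 1) T) := by
        rw [setLIntegral_congr_fun measurableSet_Ioc hstat]
    _ ≤ ENNReal.ofReal t * ∫⁻ _ in Ioc (0 : ℝ) t, ENNReal.ofReal Dsq := by
        gcongr
    _ = ENNReal.ofReal t * (ENNReal.ofReal Dsq * ENNReal.ofReal t) := by
        rw [setLIntegral_const, Real.volume_Ioc, sub_zero]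
    _ = ENNReal.ofReal (t ^ 2 * Dsq) := by
        rw [← ENNReal.ofReal_mul hDsq0, ← ENNReal.ofReal_mul ht]
        congr 1
        ring

end DriftIntegral

/-- **`N`-UNIFORM SECOND MOMENT OF THE TIME-INTEGRATED BATH-SITE DRIFT** (registered sub-goal, closed form of
`contactLoss_lintegral_driftIntegral_sq_le`): on `μ₀ ⊗ W`, `E (∫₀ᵗ Y_N(z_s) ds)² ≤ t² D²` whenever
`‖Y_N‖²_{L²(μ₀)} ≤ D²` (`t ≥ 0`; input of the `N`-uniform contact-loss theorem for `stub_forecastLoss`, line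
`two-horizons-forecast-loss`). [folklore] -/
theorem contactLoss_driftIntegralSecondMoment : ∀ ω₂ lam β γ : ℝ, 0 < ω₂ → 0 ≤ lam → 0 ≤ β → 0 ≤ γ → ∀ T : ℝ, 0 < T → ∀ (N : ℕ) (t : ℝ), 0 ≤ t → ∀ Dsq : ℝ, Integrable (fun z : PhaseSpace (N + 1) => ((pinnedChain ω₂ lam β γ).drift (N + 1) z).2 (Fin.last N) ^ 2) ((pinnedChain ω₂ lam β γ).gibbsMeasure (N + 1) T) → ∫ z, ((pinnedChain ω₂ lam β γ).drift (N + 1) z).2 (Fin.last N) ^ 2 ∂((pinnedChain ω₂ lam β γ).gibbsMeasure (N + 1) T) ≤ Dsq → ∫⁻ p, ENNReal.ofReal ((∫ s in (0 : ℝ)..t, ((pinnedChain ω₂ lam β γ).drift (N + 1) ((pinnedChain ω₂ lam β γ).solMap (N + 1) T T s p.1 (pairPath p.2))).2 (Fin.last N)) ^ 2) ∂(((pinnedChain ω₂ lam β γ).gibbsMeasure (N + 1) T).prod wienerPair) ≤ ENNReal.ofReal (t ^ 2 * Dsq) :=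
  fun _ _ _ _ hω hl hβ hγ _ hT N _ ht _ hDi hD =>
    contactLoss_lintegral_driftIntegral_sq_le hω hl hβ hγ hT N ht hDi hD

end Summit.AtomisticToContinuum.FouriersLaw.Theorems.PhononMeanFreePath

end
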